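import Mathlib
import HarnessLib
import Summits.NavierStokesRegularity.NavierStokesRegularity.Theorems.UnthreadedDoorAntidynamoWallBeltramiAccumulating
import Summits.NavierStokesRegularity.NavierStokesRegularity.Theorems.UnthreadedDoorAntidynamoWallOneInstantZonal
import Summits.NavierStokesRegularity.NavierStokesRegularity.Theorems.UnthreadedDoorCellFluxGaugeRigidityAlgebra

/-!
# Route `UnthreadedDoor` / `ThreadingFlux`, crux `PoloidalLiouville` (stmt-NavierStokesRegularity-1222), antidynamo v2 skeleton (sha16 `4ebf5683127b`),
# WALL `stub_scalarLiouville`: GENERALIZED BELTRAMI MODULO A CONSTANT DRIFT AT ACCUMULATING TIMES ⇒ IRROTATIONAL (frame-free closer)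

Support file (seat leafhand-ns-unthreadeddoor-2 g4, cell decomp-ns), `--supports stmt-NavierStokesRegularity-1222 --as helper`; theorems only.

The core of the wall (`stubScalarLiouville_of_core''''`, `…_of_core_v6`) carries two «generalized Beltrami» hypotheses: (C5) the Lamb vector is not
curl-free in any SMOOTH Galilean frame `b(t)` on a whole far past, and (C9) not curl-free in any CONSTANT (p821303) or REAL-ANALYTIC (p821364)
frame at times accumulating inside `(−∞,0)`.  This file closes the gap between them with ONE weaker, frame-free hypothesis:

* ★★ `curl_eq_zero_of_lamb_curlFree_modConst_frequently` — class + unthreaded about `x₀` + «at a set of times accumulating at some `t₀ < 0`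
  the slice is generalized Beltrami MODULO SOME CONSTANT DRIFT: `∃ b ∈ ℝ³, curl ((v(t) − b) × curl v(t)) ≡ 0`» (the constant `b` may depend on
  the time, no regularity, no frame) ⇒ `curl v ≡ 0` on `(−∞,0) × ℝ³`;
* `constant_of_lamb_curlFree_modConst_frequently` — hence slice-wise constant; `stubScalarLiouville_of_lamb_curlFree_modConst_frequently` —
  the wall's letter for this sector (the wall holds if it holds off this sector).

Mechanism (new here: an analytic SELECTION of the frame).  `curl((V − b) × ω) = curl(V × ω) + Dω·b` (`curl_lamb_modConst_eq`: `curl (b × ω) =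
−(b·∇)ω` for constant `b`, `div ω = 0`), so at each time the admissible drifts form an affine system `Dω(t,x)·b = −curl(V × ω)(t,x)` (all `x`).
If some slice has a translation-flat direction `Dω(t₁,·)·n ≡ 0`, `n ≠ 0`, the flow is trivial by ONE-INSTANT Z (`inner_curl_eq_zero_of_fderiv_curl…`
+ `OneInstant.curl_eq_zero_of_flat_direction_slice`).  Otherwise three probes `(x_k, j_k)` with non-zero triple product `d(t) = ⟪a₁, a₂ × a₃⟫` of
the row vectors exist at every time (`exists_triple_product_ne_zero`), Cramer's rule in vector form (`CellFlux.triple_smul_expand`) gives `d(t)·b = β(t)` for every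
admissible `b`, and the DIVISION-FREE field `K(t,x) = d(t)·curl(V × ω)(t,x) + Dω(t,x)·β(t)` is real-analytic in `t` (joint analyticity of the class,
`CellFlux.unthreadedAnalyticOrIrrotational`) and vanishes at the accumulating admissible times, hence on all of `(−∞,0)` (identity theorem); so
`b(t) = β(t)/d(t)` is admissible wherever `d(t) ≠ 0`, every time is admissible (re-probe at each `t₁`), the admissible drift is unique (no flat
direction) and locally `= β/d`, i.e. REAL-ANALYTIC on `(−∞,0)` — and the landed far-past closer `curl_eq_zero_of_lamb_curlFree` (p816997, smooth
frames) ends the proof.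

HONEST LABEL: a sector closer (identity theorem + linear algebra + landed closers); the generic core of the wall (= (ML-a)) is OPEN; nothing here
proves `stub_scalarLiouville`, `PoloidalLiouville` (1222), or bears on Navier–Stokes regularity; no summit statement is proved.
[folklore] [cite: MajdaBertozziCUP2002, §1.1 (vector identities); KochNadirashviliSereginSverak2009, Thm 5.2 (arXiv:0709.3599 pp. 9–10); LemarieRieusset2016, Thm. 9.12]
-/

noncomputable section

-- the summit and its single sub-problem share the name (CONVENTIONS §1)
set_option linter.dupNamespace false

open scoped Topology InnerProductSpace RealInnerProductSpace
open Filter Set Function MeasureTheory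
open Literature.Analysis Literature.Analysis.FluidPDE

namespace Summit.NavierStokesRegularity.NavierStokesRegularity.Theorems.PoloidalLiouville.Antidynamo

open Summit.NavierStokesRegularity.NavierStokesRegularity.Theorems.PoloidalLiouville
  (toroidalPotential exists_norm_curl_le constantOfIrrotational)
open Summit.NavierStokesRegularity.NavierStokesRegularity.Theorems.PoloidalLiouville.NetFlux (E3)

namespace ModConst

/-! ### §1 Linear algebra in `ℝ³` (the reciprocal-basis expansion `CellFlux.triple_smul_expand` and the rank-≤-2 lemma
`CellFlux.exists_ne_zero_forall_inner_eq_zero` are imported from `UnthreadedDoorCellFluxGaugeRigidityAlgebra`, p-landed) -/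

/-- **Selection of three probes** (contrapositive of the rank-≤-2 lemma `CellFlux.exists_ne_zero_forall_inner_eq_zero`): if a family of vectors
`A i` has no non-zero common orthogonal vector, three of them have non-zero triple product. [folklore] -/
theorem exists_triple_product_ne_zero {ι : Type*} (A : ι → E3) (h : ∀ n : E3, n ≠ 0 → ∃ i, ⟪A i, n⟫ ≠ 0) :
    ∃ i j k, ⟪A i, cross (A j) (A k)⟫ ≠ 0 := by
  by_contra hall
  push Not at hall
  obtain ⟨e, he, horth⟩ := CellFlux.exists_ne_zero_forall_inner_eq_zero A hall
  obtain ⟨i, hi⟩ := h e he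
  exact hi (by rw [real_inner_comm]; exact horth i)

/-- `⟪Σ cᵢ eᵢ, b⟫ = Σ cᵢ bᵢ`. [folklore] -/
theorem inner_sum_smul_single (c : Fin 3 → ℝ) (b : E3) :
    ⟪∑ i : Fin 3, c i • (EuclideanSpace.single i (1 : ℝ) : E3), b⟫ = ∑ i, c i * b i := by
  simp [sum_inner, inner_smul_left, EuclideanSpace.inner_single_left]

/-! ### §2 One slice: the Lamb vector modulo a constant drift -/

/-- **`curl ((V − b) × curl V) = curl (V × curl V) + D(curl V)·b`** for a constant `b` and `V ∈ C²` (`curl (b × ω) = (div ω) b − (b·∇)ω` and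
`div curl = 0`). [cite: MajdaBertozziCUP2002, §1.1 (vector identities)] -/
theorem curl_lamb_modConst_eq {V : E3 → E3} (hV : ContDiff ℝ 2 V) (b x : E3) :
    curl (fun y => cross (V y - b) (curl V y)) x =
      curl (fun y => cross (V y) (curl V y)) x + fderiv ℝ (curl V) x b := by
  have hω : ContDiff ℝ 1 (curl V) := contDiff_curl (n := 1) (hV.of_le (by norm_num))
  have hVd : DifferentiableAt ℝ V x := (hV.differentiable (by norm_num)) x
  have hωd : DifferentiableAt ℝ (curl V) x := (hω.differentiable one_ne_zero) x
  have h1 : (fun y => cross (V y - b) (curl V y)) = fun y => cross (V y) (curl V y) - cross b (curl V y) := by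
    funext y
    simp only [← crossCLM_apply, map_sub, sub_apply]
  have hd1 : DifferentiableAt ℝ (fun y => cross (V y) (curl V y)) x :=
    (hasFDerivAt_cross hVd.hasFDerivAt hωd.hasFDerivAt).differentiableAt
  have hd2 : DifferentiableAt ℝ (fun y => cross b (curl V y)) x :=
    (hasFDerivAt_cross (hasFDerivAt_const b x) hωd.hasFDerivAt).differentiableAt
  have hdc : VectorCalculus.divergence (fun _ : E3 => b) x = 0 := by
    simp [VectorCalculus.divergence]
  rw [h1, curl_sub hd1 hd2, curl_cross_apply (differentiableAt_const b) hωd, divergence_curl_eq_zero_holds V hV x, hdc]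
  simp

/-- **Affine expansion in the standard basis**: `curl ((V − b) × ω) = curl ((V − 0) × ω) + Σᵢ bᵢ · (curl ((V − eᵢ) × ω) − curl ((V − 0) × ω))`. [folklore] -/
theorem curl_lamb_modConst_expand {V : E3 → E3} (hV : ContDiff ℝ 2 V) (b x : E3) :
    curl (fun y => cross (V y - b) (curl V y)) x =
      curl (fun y => cross (V y - 0) (curl V y)) x +
        ∑ i : Fin 3, b i • (curl (fun y => cross (V y - EuclideanSpace.single i 1) (curl V y)) x -
          curl (fun y => cross (V y - 0) (curl V y)) x) := by
  simp only [curl_lamb_modConst_eq hV, map_zero, add_zero, add_sub_cancel_left]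
  congr 1
  conv_lhs => rw [show b = ∑ i, b i • EuclideanSpace.single i (1 : ℝ) by
    simpa using ((EuclideanSpace.basisFun (Fin 3) ℝ).sum_repr b).symm]
  simp [map_sum, map_smul]

/-- **The probe functional**: the vector `a = Σᵢ (curl((V − eᵢ) × ω) − curl((V − 0) × ω))ⱼ(x) eᵢ` represents `b ↦ (D(curl V)(x) b)ⱼ`. [folklore] -/
theorem inner_probe_eq {V : E3 → E3} (hV : ContDiff ℝ 2 V) (x n : E3) (j : Fin 3) :
    ⟪∑ i : Fin 3, ((curl (fun y => cross (V y - EuclideanSpace.single i 1) (curl V y)) x -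
        curl (fun y => cross (V y - 0) (curl V y)) x) j) • (EuclideanSpace.single i (1 : ℝ) : E3), n⟫ =
      (fderiv ℝ (curl V) x n) j := by
  rw [inner_sum_smul_single]
  simp only [curl_lamb_modConst_eq hV, map_zero, add_zero, add_sub_cancel_left]
  conv_rhs => rw [show n = ∑ i, n i • EuclideanSpace.single i (1 : ℝ) by
    simpa using ((EuclideanSpace.basisFun (Fin 3) ℝ).sum_repr n).symm]
  simp [map_sum, map_smul, WithLp.ofLp_sum, Finset.sum_apply, mul_comm]

/-- **Uniqueness of the drift off flat directions**: two admissible constant drifts differ by a translation-flat direction of the vorticity. [folklore] -/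
theorem fderiv_curl_sub_eq_zero_of_lamb {V : E3 → E3} (hV : ContDiff ℝ 2 V) {b b' : E3}
    (hb : ∀ x, curl (fun y => cross (V y - b) (curl V y)) x = 0) (hb' : ∀ x, curl (fun y => cross (V y - b') (curl V y)) x = 0)
    (x : E3) : fderiv ℝ (curl V) x (b - b') = 0 := by
  have h1 := curl_lamb_modConst_eq hV b x
  have h2 := curl_lamb_modConst_eq hV b' x
  rw [hb x] at h1
  rw [hb' x] at h2
  rw [map_sub, sub_eq_zero]
  exact add_left_cancel (h1.symm.trans h2)


/-! ### ★★ §3 Generalized Beltrami modulo a constant drift at accumulating times -/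

/-- ★★ **GENERALIZED BELTRAMI MODULO A CONSTANT DRIFT AT ACCUMULATING TIMES ⇒ IRROTATIONAL** (frame-free: the constant may depend on the time, with no
regularity).  Let `v` be a bounded ancient mild solution (`ν = 1`, duality class) with measurable slices, jointly smooth on `(−∞,0) × ℝ³`, whose vorticity
is tangent to the spheres about `x₀`.  If at a set of times accumulating at some `t₀ < 0` there is SOME constant `b` (depending on the time) with
`curl ((v(t) − b) × curl v(t)) ≡ 0`, then `curl v ≡ 0` on `(−∞,0) × ℝ³` (module docstring for the proof: flat direction ⇒ one-instant Z; otherwise an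
analytic selection of the drift by Cramer's rule and the identity theorem, then the far-past closer in the selected real-analytic frame).
[cite: KochNadirashviliSereginSverak2009, Thm 5.2 (arXiv:0709.3599 pp. 9–10); MajdaBertozziCUP2002, §1.1 (vector identities); LemarieRieusset2016, Thm. 9.12] -/
theorem curl_eq_zero_of_lamb_curlFree_modConst_frequently
    (v : ℝ → EuclideanSpace ℝ (Fin 3) → EuclideanSpace ℝ (Fin 3)) (x₀ : EuclideanSpace ℝ (Fin 3))
    (hB : Literature.Analysis.FluidPDE.IsBoundedAncientMildSolution 1 v)
    (hm : ∀ t < 0, AEStronglyMeasurable (v t) volume)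
    (hsm : ContDiffOn ℝ (⊤ : ℕ∞) (Function.uncurry v) (Set.Iio 0 ×ˢ Set.univ))
    (hun : ∀ t < 0, ∀ x, ⟪x - x₀, curl (v t) x⟫ = 0)
    (hfr : ∃ t₀ < 0, ∃ᶠ t in 𝓝[≠] t₀, ∃ b : EuclideanSpace ℝ (Fin 3),
      ∀ x, curl (fun y => cross (v t y - b) (curl (v t) y)) x = 0) :
    ∀ t < 0, ∀ x, curl (v t) x = 0 := by
  obtain ⟨t₀, ht₀, hfr⟩ := hfr
  obtain ⟨K, hK⟩ := exists_norm_curl_le hB hsm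
  obtain ⟨T, -, -, hlink⟩ := toroidalPotential v x₀ K hsm hK hun
  rcases CellFlux.unthreadedAnalyticOrIrrotational v x₀ T hB hm hsm hlink with hA | hZ
  swap
  · exact hZ
  have hsm' : IsSmoothSpaceTimeOn (Iio 0) v := hsm
  have hv2 : ∀ t < 0, ContDiff ℝ 2 (v t) := fun t ht => (hsm'.contDiff_slice ht).of_le (by norm_cast)
  -- ## Case 1: a translation-flat direction of the vorticity at one instant ⇒ one-instant Z
  by_cases hflat : ∃ t₁ < 0, ∃ n : EuclideanSpace ℝ (Fin 3), n ≠ 0 ∧ ∀ x, fderiv ℝ (curl (v t₁)) x n = 0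
  · obtain ⟨t₁, ht₁, n, hn, hD⟩ := hflat
    exact OneInstant.curl_eq_zero_of_flat_direction_slice v x₀ hB hm hsm hun
      ⟨t₁, ht₁, n, hn, inner_curl_eq_zero_of_fderiv_curl_apply_eq_zero (hv2 t₁ ht₁) x₀ n (hun t₁ ht₁) hD⟩
  push Not at hflat
  -- ## Case 2: no flat direction at any instant — analytic selection of the drift
  -- the Lamb-curl in the constant frame `c` at the point `x`, as a function of time
  set F : E3 → E3 → ℝ → E3 := fun c x t => curl (fun y => cross (v t y - c) (curl (v t) y)) x with hF
  have hFa : ∀ c x, AnalyticOnNhd ℝ (F c x) (Iio 0) := fun c x => OneInstant.analyticOnNhd_curl_lamb_slice c hA x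
  have hFja : ∀ c x (j : Fin 3), AnalyticOnNhd ℝ (fun t => F c x t j) (Iio 0) := fun c x j =>
    ((EuclideanSpace.proj j : E3 →L[ℝ] ℝ).comp_analyticOnNhd (hFa c x)).congr isOpen_Iio (fun t _ => rfl)
  -- single-slice facts in the letters of `F`
  have hexpand : ∀ t < 0, ∀ b x, F b x t = F 0 x t + ∑ i : Fin 3, b i • (F (EuclideanSpace.single i 1) x t - F 0 x t) :=
    fun t ht b x => by simpa only [hF] using ModConst.curl_lamb_modConst_expand (hv2 t ht) b x
  have hprobe : ∀ t < 0, ∀ x n (j : Fin 3),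
      ⟪∑ i : Fin 3, ((F (EuclideanSpace.single i 1) x t - F 0 x t) j) • (EuclideanSpace.single i (1 : ℝ) : E3), n⟫ =
        (fderiv ℝ (curl (v t)) x n) j :=
    fun t ht x n j => by simpa only [hF] using ModConst.inner_probe_eq (hv2 t ht) x n j
  have huniq : ∀ t < 0, ∀ b b' : E3, (∀ x, F b x t = 0) → (∀ x, F b' x t = 0) → b = b' := by
    intro t ht b b' hb hb'
    by_contra hne
    obtain ⟨x, hx⟩ := hflat t ht (b - b') (sub_ne_zero.2 hne)
    exact hx (ModConst.fderiv_curl_sub_eq_zero_of_lamb (hv2 t ht) (fun x => by simpa only [hF] using hb x)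
      (fun x => by simpa only [hF] using hb' x) x)
  -- probe vectors, determinant, Cramer numerator, division-free field — for an arbitrary probe triple `(xs k, js k)`
  set a : (Fin 3 → E3) → (Fin 3 → Fin 3) → Fin 3 → ℝ → E3 := fun xs js k t =>
    ∑ i : Fin 3, ((F (EuclideanSpace.single i 1) (xs k) t - F 0 (xs k) t) (js k)) • (EuclideanSpace.single i (1 : ℝ) : E3) with ha
  set d : (Fin 3 → E3) → (Fin 3 → Fin 3) → ℝ → ℝ := fun xs js t =>
    ⟪a xs js 0 t, cross (a xs js 1 t) (a xs js 2 t)⟫ with hd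
  set g : (Fin 3 → E3) → (Fin 3 → Fin 3) → Fin 3 → ℝ → ℝ := fun xs js k t => -(F 0 (xs k) t (js k)) with hg
  set β : (Fin 3 → E3) → (Fin 3 → Fin 3) → ℝ → E3 := fun xs js t =>
    g xs js 0 t • cross (a xs js 1 t) (a xs js 2 t) + g xs js 1 t • cross (a xs js 2 t) (a xs js 0 t) +
      g xs js 2 t • cross (a xs js 0 t) (a xs js 1 t) with hβ
  set Kf : (Fin 3 → E3) → (Fin 3 → Fin 3) → E3 → ℝ → E3 := fun xs js x t =>
    d xs js t • F 0 x t + ∑ i : Fin 3, (β xs js t) i • (F (EuclideanSpace.single i 1) x t - F 0 x t) with hKf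
  -- analyticity in time of all of them
  have hcross : ∀ f₁ f₂ : ℝ → E3, AnalyticOnNhd ℝ f₁ (Iio 0) → AnalyticOnNhd ℝ f₂ (Iio 0) →
      AnalyticOnNhd ℝ (fun t => cross (f₁ t) (f₂ t)) (Iio 0) := fun f₁ f₂ h₁ h₂ =>
    (crossCLM.analyticOnNhd_bilinear (univ : Set (E3 × E3))).comp (h₁.prod h₂) (mapsTo_univ _ _)
  have hinner : ∀ f₁ f₂ : ℝ → E3, AnalyticOnNhd ℝ f₁ (Iio 0) → AnalyticOnNhd ℝ f₂ (Iio 0) →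
      AnalyticOnNhd ℝ (fun t => ⟪f₁ t, f₂ t⟫) (Iio 0) := fun f₁ f₂ h₁ h₂ =>
    (((innerSL ℝ : E3 →L[ℝ] E3 →L[ℝ] ℝ).analyticOnNhd_bilinear (univ : Set (E3 × E3))).comp (h₁.prod h₂)
      (mapsTo_univ _ _)).congr isOpen_Iio (fun t _ => innerSL_apply_apply (𝕜 := ℝ) _ _)
  have haa : ∀ xs js k, AnalyticOnNhd ℝ (a xs js k) (Iio 0) := fun xs js k =>
    Finset.analyticOnNhd_fun_sum _ fun i _ =>
      (((EuclideanSpace.proj (js k) : E3 →L[ℝ] ℝ).comp_analyticOnNhd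
        ((hFa _ (xs k)).sub (hFa 0 (xs k)))).congr isOpen_Iio (fun t _ => rfl)).smul analyticOnNhd_const
  have hda : ∀ xs js, AnalyticOnNhd ℝ (d xs js) (Iio 0) := fun xs js =>
    hinner _ _ (haa xs js 0) (hcross _ _ (haa xs js 1) (haa xs js 2))
  have hga : ∀ xs js k, AnalyticOnNhd ℝ (g xs js k) (Iio 0) := fun xs js k => (hFja 0 (xs k) (js k)).neg
  have hβa : ∀ xs js, AnalyticOnNhd ℝ (β xs js) (Iio 0) := fun xs js =>
    (((hga xs js 0).smul (hcross _ _ (haa xs js 1) (haa xs js 2))).add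
      ((hga xs js 1).smul (hcross _ _ (haa xs js 2) (haa xs js 0)))).add
      ((hga xs js 2).smul (hcross _ _ (haa xs js 0) (haa xs js 1)))
  have hKa : ∀ xs js x, AnalyticOnNhd ℝ (Kf xs js x) (Iio 0) := fun xs js x =>
    ((hda xs js).smul (hFa 0 x)).add (Finset.analyticOnNhd_fun_sum _ fun i _ =>
      (((EuclideanSpace.proj i : E3 →L[ℝ] ℝ).comp_analyticOnNhd (hβa xs js)).congr isOpen_Iio (fun t _ => rfl)).smul
        ((hFa _ x).sub (hFa 0 x)))
  -- the key algebra: `d • F b = Kf` as soon as `d • b = β`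
  have hKey : ∀ xs js, ∀ t < 0, ∀ (b x : E3), d xs js t • b = β xs js t → d xs js t • F b x t = Kf xs js x t := by
    intro xs js t ht b x hb
    simp only [hKf, ← hb, PiLp.smul_apply, smul_eq_mul, mul_smul, ← Finset.smul_sum, ← smul_add]
    rw [← hexpand t ht b x]
  -- Cramer: an admissible drift `b` at time `t` has `d • b = β`
  have hCramer : ∀ xs js, ∀ t < 0, ∀ b : E3, (∀ x, F b x t = 0) → d xs js t • b = β xs js t := by
    intro xs js t ht b hb
    have hrow : ∀ k, ⟪a xs js k t, b⟫ = g xs js k t := by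
      intro k
      simp only [ha, hg, ModConst.inner_sum_smul_single]
      have h0 := congrArg (fun w : E3 => w (js k)) (hexpand t ht b (xs k))
      simp only [hb, PiLp.zero_apply, PiLp.add_apply, WithLp.ofLp_sum, Finset.sum_apply, PiLp.smul_apply, PiLp.sub_apply,
        smul_eq_mul] at h0
      have hcomm : ∑ i : Fin 3, (F (EuclideanSpace.single i 1) (xs k) t - F 0 (xs k) t) (js k) * b i =
          ∑ i : Fin 3, b i * ((F (EuclideanSpace.single i 1) (xs k) t) (js k) - (F 0 (xs k) t) (js k)) :=
        Finset.sum_congr rfl fun i _ => by rw [PiLp.sub_apply]; ring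
      rw [hcomm]
      linarith
    simp only [hd, hβ, CellFlux.triple_smul_expand, hrow]
  -- the division-free field vanishes at every admissible time …
  have hKzero_adm : ∀ xs js, ∀ t < 0, (∃ b : E3, ∀ x, F b x t = 0) → ∀ x, Kf xs js x t = 0 := by
    rintro xs js t ht ⟨b, hb⟩ x
    rw [← hKey xs js t ht b x (hCramer xs js t ht b hb), hb x, smul_zero]
  -- … hence, by the identity theorem in `t`, at EVERY time
  have hneg0 : ∀ᶠ t in 𝓝 t₀, t < 0 := Iio_mem_nhds ht₀
  have hneg : ∀ᶠ t in 𝓝[≠] t₀, t < 0 := hneg0.filter_mono nhdsWithin_le_nhds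
  have hKzero : ∀ xs js x, ∀ t < 0, Kf xs js x t = 0 := by
    intro xs js x t ht
    have hfrK : ∃ᶠ s in 𝓝[≠] t₀, Kf xs js x s = 0 :=
      (hfr.and_eventually hneg).mono fun s ⟨hs, hs0⟩ => hKzero_adm xs js s hs0 (by simpa only [hF] using hs) x
    have h0 := (hKa xs js x).eqOn_zero_of_preconnected_of_frequently_eq_zero isPreconnected_Iio ht₀ hfrK ht
    simpa only [Pi.zero_apply] using h0
  -- wherever the determinant of a probe triple is non-zero, `β/d` is an admissible drift
  have hadm : ∀ xs js, ∀ t < 0, d xs js t ≠ 0 → ∀ x, F ((d xs js t)⁻¹ • β xs js t) x t = 0 := by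
    intro xs js t ht hdt x
    have h1 := hKey xs js t ht ((d xs js t)⁻¹ • β xs js t) x (by rw [smul_smul, mul_inv_cancel₀ hdt, one_smul])
    rw [hKzero xs js x t ht] at h1
    exact (smul_eq_zero.1 h1).resolve_left hdt
  -- at every time there IS a probe triple with non-zero determinant (no flat direction)
  have hdet : ∀ t < 0, ∃ xs js, d xs js t ≠ 0 := by
    intro t ht
    obtain ⟨p, q, r, hpqr⟩ := ModConst.exists_triple_product_ne_zero
      (fun p : E3 × Fin 3 => ∑ i : Fin 3, ((F (EuclideanSpace.single i 1) p.1 t - F 0 p.1 t) p.2) •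
        (EuclideanSpace.single i (1 : ℝ) : E3)) (fun n hn => by
          obtain ⟨x, hx⟩ := hflat t ht n hn
          obtain ⟨j, hj⟩ : ∃ j : Fin 3, (fderiv ℝ (curl (v t)) x n) j ≠ 0 := by
            by_contra hall
            push Not at hall
            exact hx (PiLp.ext fun j => by simpa using hall j)
          exact ⟨(x, j), by rw [hprobe t ht x n j]; exact hj⟩)
    refine ⟨![p.1, q.1, r.1], ![p.2, q.2, r.2], ?_⟩
    simpa only [hd, ha, Matrix.cons_val_zero, Matrix.cons_val_one, Matrix.cons_val_two, Matrix.head_cons, Matrix.tail_cons]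
      using hpqr
  -- ## the selected drift: admissible at every time, unique, locally `β/d`, hence real-analytic
  have hgood : ∀ t, ∃ c : E3, t < 0 → ∀ x, F c x t = 0 := by
    intro t
    by_cases ht : t < 0
    · obtain ⟨xs, js, hdt⟩ := hdet t ht
      exact ⟨_, fun _ => hadm xs js t ht hdt⟩
    · exact ⟨0, fun h => absurd h ht⟩
  choose bsel hbsel using hgood
  have hban : AnalyticOnNhd ℝ bsel (Iio 0) := by
    intro t₁ ht₁
    obtain ⟨xs, js, hdt⟩ := hdet t₁ ht₁
    have hloc : AnalyticAt ℝ (fun t => (d xs js t)⁻¹ • β xs js t) t₁ := ((hda xs js t₁ ht₁).inv hdt).smul (hβa xs js t₁ ht₁)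
    refine hloc.congr ?_
    have hne : ∀ᶠ t in 𝓝 t₁, d xs js t ≠ 0 := (hda xs js t₁ ht₁).continuousAt.eventually_ne hdt
    filter_upwards [hne, Iio_mem_nhds ht₁] with t hdt' ht
    exact huniq t ht _ _ (hadm xs js t ht hdt') (hbsel t ht)
  have hbC : ContDiffOn ℝ (⊤ : ℕ∞) bsel (Iio 0) := hban.contDiffOn_of_completeSpace
  exact curl_eq_zero_of_lamb_curlFree v x₀ hB hm hsm hun bsel hbC fun t ht x => by
    simpa only [hF] using hbsel t ht x

/-- ★★ **… HENCE SLICE-WISE CONSTANT.** [cite: KochNadirashviliSereginSverak2009, Thm 5.2 (arXiv:0709.3599 pp. 9–10)] -/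
theorem constant_of_lamb_curlFree_modConst_frequently
    (v : ℝ → EuclideanSpace ℝ (Fin 3) → EuclideanSpace ℝ (Fin 3)) (x₀ : EuclideanSpace ℝ (Fin 3))
    (hB : Literature.Analysis.FluidPDE.IsBoundedAncientMildSolution 1 v)
    (hm : ∀ t < 0, AEStronglyMeasurable (v t) volume)
    (hsm : ContDiffOn ℝ (⊤ : ℕ∞) (Function.uncurry v) (Set.Iio 0 ×ˢ Set.univ))
    (hun : ∀ t < 0, ∀ x, ⟪x - x₀, curl (v t) x⟫ = 0)
    (hfr : ∃ t₀ < 0, ∃ᶠ t in 𝓝[≠] t₀, ∃ b : EuclideanSpace ℝ (Fin 3),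
      ∀ x, curl (fun y => cross (v t y - b) (curl (v t) y)) x = 0) :
    ∀ t < 0, ∃ c : EuclideanSpace ℝ (Fin 3), ∀ x, v t x = c :=
  constantOfIrrotational v hB hsm (curl_eq_zero_of_lamb_curlFree_modConst_frequently v x₀ hB hm hsm hun hfr)


/-! ### §4 The wall's letter for this sector -/

/-- **THE WALL ON THE «GENERALIZED BELTRAMI MODULO CONSTANTS AT ACCUMULATING TIMES» SECTOR.**  `StubScalarLiouville` holds as soon as its conclusion
is known for the flows of its class that are at NO set of times accumulating inside `(−∞,0)` generalized Beltrami modulo a constant drift (hypothesis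
`hrest`); the complementary sector is closed by `curl_eq_zero_of_lamb_curlFree_modConst_frequently`.  This single free hypothesis replaces both
(C5) (smooth far-past frames, p817315) and (C9) (constant / real-analytic frames at accumulating times, p821303 / p821364) of the core.
[cite: KochNadirashviliSereginSverak2009, Thm 5.2 (arXiv:0709.3599 pp. 9–10)] -/
theorem stubScalarLiouville_of_lamb_curlFree_modConst_frequently
    (hrest : ∀ (v : ℝ → EuclideanSpace ℝ (Fin 3) → EuclideanSpace ℝ (Fin 3)) (x₀ : EuclideanSpace ℝ (Fin 3))
      (T : ℝ → EuclideanSpace ℝ (Fin 3) → ℝ),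
      Literature.Analysis.FluidPDE.IsBoundedAncientMildSolution 1 v →
      (∀ t < 0, AEStronglyMeasurable (v t) volume) →
      ContDiffOn ℝ (⊤ : ℕ∞) (Function.uncurry v) (Set.Iio 0 ×ˢ Set.univ) →
      ContDiffOn ℝ (⊤ : ℕ∞) (Function.uncurry T) (Set.Iio 0 ×ˢ ({x₀}ᶜ : Set (EuclideanSpace ℝ (Fin 3)))) →
      (∃ C : ℝ, ∀ t < 0, ∀ x, |T t x| ≤ C) →
      (∀ t < 0, ∀ x, Literature.Analysis.FluidPDE.curl (v t) x =
        Literature.Analysis.FluidPDE.cross (gradient (T t) x) (x - x₀)) →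
      (∀ t < 0, ∀ x, x ≠ x₀ →
        Literature.Analysis.FluidPDE.cross
            (gradient (fun z => deriv (fun s => T s z) t + inner ℝ (v t z) (gradient (T t) z)
              - Laplacian.laplacian (T t) z) x) (x - x₀) =
          Literature.Analysis.FluidPDE.cross (gradient (fun z => inner ℝ (v t z) (z - x₀)) x) (gradient (T t) x)) →
      (∀ t₀ < 0, ¬ ∃ᶠ t in 𝓝[≠] t₀, ∃ b : EuclideanSpace ℝ (Fin 3),
        ∀ x, curl (fun y => cross (v t y - b) (curl (v t) y)) x = 0) →
      ∀ t < 0, ∀ x, Literature.Analysis.FluidPDE.cross (gradient (T t) x) (x - x₀) = 0) :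
    StubScalarLiouville := by
  intro v x₀ T hB hm hsm hT hTb hrep hE
  -- the flow is unthreaded about `x₀` (a toroidal field is tangent to the spheres about its centre)
  have hun : ∀ s < 0, ∀ z, ⟪z - x₀, curl (v s) z⟫ = 0 := fun s hs z => by
    rw [hrep s hs z]
    simp [cross, crossProduct, PiLp.inner_apply, Fin.sum_univ_three]
    ring
  by_cases hsec : ∃ t₀ < 0, ∃ᶠ t in 𝓝[≠] t₀, ∃ b : EuclideanSpace ℝ (Fin 3),
      ∀ x, curl (fun y => cross (v t y - b) (curl (v t) y)) x = 0
  · intro t ht x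
    rw [← hrep t ht x]
    exact curl_eq_zero_of_lamb_curlFree_modConst_frequently v x₀ hB hm hsm hun hsec t ht x
  · exact hrest v x₀ T hB hm hsm hT hTb hrep hE (fun t₀ ht₀ h => hsec ⟨t₀, ht₀, h⟩)

end ModConst

end Summit.NavierStokesRegularity.NavierStokesRegularity.Theorems.PoloidalLiouville.Antidynamo

end
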